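import Literature.NumberTheory.EllipticCurves.ModularSymbolsSubquotients
import Literature.NumberTheory.EllipticCurves.ModularSymbolsDistributionCoefficients
import Literature.NumberTheory.EllipticCurves.PAdicMeasureMomentFiltrationLower
import HarnessLib

/-!
# The integral coefficient system `𝔻⁰_k(ℤ_p)` on `Σ₀(N)`, its finite approximations `𝔻⁰/K_n`, and
# the ordinary projector on their modular symbols

Instantiation of `ModularSymbolsSubquotients` for measures (Greenberg–Stevens 1993, §1; Greenberg 2007,
§3), for a level `N` with `p ∣ N`:

* `sigma0Set N` is multiplicatively closed (`mul_mem_sigma0Set`);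
* **`distCoeffInt p k N`**: the `ℤ_p`-module `𝔻⁰ = 𝔻⁰(ℤ_p)` of `ℤ_p`-valued measures with the weight-`k`
  action of `Σ₀(N)` (restriction of `distCoeff`, using `weightActD_mem_distributionsInt`);
* its invariant submodules: the congruence submodules `K_n` (`congrSubInt`, `isInvariant_congrSubInt`,
  from `weightActD_mem_congrSub`) and Greenberg's filtration `F^N 𝔻⁰_k` (`filGInt`, `isInvariant_filGInt`,
  from `weightActD_mem_filG`);
* **finiteness of `𝔻⁰/K_n`** (`finite_quot_congrSubInt`, from the reduction map `reduce` of
  `PAdicMeasureLattice`), hence the FINITE coefficient systems `approxCoeff p k N n = 𝔻⁰/K_n` with their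
  `U_p` (`heckeApprox`) and **Hida's ordinary projector `ordApprox` on `Symb_{Γ₀(N)}(𝔻⁰/K_n)`**
  (`ModularSymbolsSubquotients.ordProjSymb`), compatible with the transition maps
  `𝔻⁰/K_{n'} → 𝔻⁰/K_n` (`transHom`, `mapSymb_trans_ordApprox`).

This is the profinite tower `Symb(𝔻⁰) = lim_n Symb(𝔻⁰/K_n)` on which `e = lim U_p^{m!}` is defined
levelwise. Brick B2k of the bottom-up plan recorded with the named fact
`greenbergStevens_kitagawa_twoVariable_interpolation_allBranches`.  Everything is proved; no named facts.

## References

* R. Greenberg, G. Stevens, Invent. Math. 111 (1993), §1. [GreenbergStevens1993]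
* M. Greenberg, Israel J. Math. 161 (2007), §3. [Greenberg2007Lifting]
-/

noncomputable section

open scoped MatrixGroups
open Matrix CongruenceSubgroup

namespace Literature.NumberTheory.EllipticCurves

open ModularForms ModularForms.HidaCohomology

variable {p : ℕ} [Fact p.Prime]

/-! ### `Σ₀(N)` is a semigroup -/

/-- **`Σ₀(N)` is multiplicatively closed.** [folklore] -/
theorem mul_mem_sigma0Set {N : ℕ} {M M' : Matrix (Fin 2) (Fin 2) ℤ} (hM : M ∈ sigma0Set N) (hM' : M' ∈ sigma0Set N) :
    M * M' ∈ sigma0Set N := by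
  refine ⟨by rw [Matrix.det_mul]; exact mul_ne_zero hM.1 hM'.1, ?_, ?_⟩
  · have e : (M * M') 1 0 = M 1 0 * M' 0 0 + M 1 1 * M' 1 0 := by
      simp [Matrix.mul_apply, Fin.sum_univ_two]
    rw [e]
    exact dvd_add (dvd_mul_of_dvd_left hM.2.1 _) (dvd_mul_of_dvd_right hM'.2.1 _)
  · have e : (M * M') 0 0 = M 0 0 * M' 0 0 + M 0 1 * M' 1 0 := by
      simp [Matrix.mul_apply, Fin.sum_univ_two]
    obtain ⟨t, ht⟩ := hM'.2.1
    rw [e, ht, show M 0 1 * ((N : ℤ) * t) = (N : ℤ) * (M 0 1 * t) by ring]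
    exact (IsCoprime.mul_left hM.2.2 hM'.2.2).add_mul_left_left (M 0 1 * t)

/-- `hS` for `sigma0Set N` in the form `ModularSymbolsSubquotients` wants. [folklore] -/
theorem sigma0Set_mulClosed (N : ℕ) : ∀ M ∈ sigma0Set N, ∀ M' ∈ sigma0Set N, M * M' ∈ sigma0Set N :=
  fun _ hM _ hM' => mul_mem_sigma0Set hM hM'

/-! ### The integral coefficient system `𝔻⁰_k` -/

section DInt

variable (p) in
/-- The `ℤ_p`-module `𝔻⁰(ℤ_p)` of `ℤ_p`-valued measures on `ℤ_p` (as a type). [cite: GreenbergStevens1993, §1] -/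
abbrev DInt : Type := ↥((ProfiniteTower.padicInt p).distributionsInt p)

/-- An integral measure as an element of `𝔻(ℤ_p, ℚ_p)`. [folklore] -/
def DInt.toDist (μ : DInt p) : (ProfiniteTower.padicInt p).distributions ℚ_[p] := ⟨μ.1, μ.2.1⟩

/-- Level data of `toDist`. [folklore] -/
@[simp] theorem DInt.toDist_val (μ : DInt p) : (DInt.toDist μ).1 = μ.1 := rfl

/-- `toDist` is additive. [folklore] -/
theorem DInt.toDist_add (μ ν : DInt p) : DInt.toDist (μ + ν) = DInt.toDist μ + DInt.toDist ν := rfl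

/-- `toDist` is `ℤ_p`-semilinear for the `ℚ_p`-structure. [folklore] -/
theorem DInt.toDist_smul (c : ℤ_[p]) (μ : DInt p) : DInt.toDist (c • μ) = (c : ℚ_[p]) • DInt.toDist μ := rfl

/-- The operator `distρ M` preserves integrality. [folklore] -/
theorem distρ_val_mem_distributionsInt (k : ℕ) (M : Matrix (Fin 2) (Fin 2) ℤ) (μ : DInt p) :
    (distρ p ℚ_[p] k M (DInt.toDist μ)).1 ∈ (ProfiniteTower.padicInt p).distributionsInt p := by
  unfold distρ
  split_ifs with h
  · exact weightActD_mem_distributionsInt k h.1 h.2 _ _ _ μ.2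
  · exact μ.2

variable (p) in
/-- **The operator of an integer matrix on `𝔻⁰`** (restriction of `distρ`). [folklore] -/
def distρInt (k : ℕ) (M : Matrix (Fin 2) (Fin 2) ℤ) : DInt p →ₗ[ℤ_[p]] DInt p where
  toFun μ := ⟨(distρ p ℚ_[p] k M (DInt.toDist μ)).1, distρ_val_mem_distributionsInt k M μ⟩
  map_add' μ ν := by
    refine Subtype.ext ?_
    change (distρ p ℚ_[p] k M (DInt.toDist (μ + ν))).1 = (distρ p ℚ_[p] k M (DInt.toDist μ)).1 + (distρ p ℚ_[p] k M (DInt.toDist ν)).1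
    rw [DInt.toDist_add, map_add]; rfl
  map_smul' c μ := by
    refine Subtype.ext ?_
    change (distρ p ℚ_[p] k M (DInt.toDist (c • μ))).1 = c • (distρ p ℚ_[p] k M (DInt.toDist μ)).1
    rw [DInt.toDist_smul, map_smul]; rfl

/-- Level data of `distρInt`. [folklore] -/
@[simp] theorem distρInt_val (k : ℕ) (M : Matrix (Fin 2) (Fin 2) ℤ) (μ : DInt p) :
    (distρInt p k M μ).1 = (distρ p ℚ_[p] k M (DInt.toDist μ)).1 := rfl

/-- `toDist` intertwines `distρInt` and `distρ`. [folklore] -/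
theorem toDist_distρInt (k : ℕ) (M : Matrix (Fin 2) (Fin 2) ℤ) (μ : DInt p) :
    DInt.toDist (distρInt p k M μ) = distρ p ℚ_[p] k M (DInt.toDist μ) := rfl

variable (p) in
/-- **The integral coefficient system `𝔻⁰_k` on `Σ₀(N)`** (`p ∣ N`): `ℤ_p`-valued measures on `ℤ_p`
with the weight-`k` action. [cite: GreenbergStevens1993, §1] -/
def distCoeffInt (k N : ℕ) (hpN : p ∣ N) : CoeffActionOn (sigma0Set N) ℤ_[p] (DInt p) where
  ρ := distρInt p k
  ρ_mul M hM M' hM' := by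
    refine LinearMap.ext fun μ => Subtype.ext ?_
    have h := congrArg Subtype.val (LinearMap.congr_fun ((distCoeff p ℚ_[p] k N hpN).ρ_mul M hM M' hM') (DInt.toDist μ))
    simp only [distCoeff_ρ, LinearMap.comp_apply] at h ⊢
    rw [distρInt_val, h]
    rfl
  ρ_one := by
    refine LinearMap.ext fun μ => Subtype.ext ?_
    have h := congrArg Subtype.val (LinearMap.congr_fun (distCoeff p ℚ_[p] k N hpN).ρ_one (DInt.toDist μ))
    simp only [distCoeff_ρ, LinearMap.id_apply] at h ⊢
    rw [distρInt_val, h]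
    rfl

/-- The operators of `distCoeffInt`. [folklore] -/
theorem distCoeffInt_ρ (k N : ℕ) (hpN : p ∣ N) (M : Matrix (Fin 2) (Fin 2) ℤ) :
    (distCoeffInt p k N hpN).ρ M = distρInt p k M := rfl

/-- On `Σ₀(N)` the operator is the weight-`k` action. [folklore] -/
theorem distρInt_val_eq_weightActD (k : ℕ) {N : ℕ} (hpN : p ∣ N) {M : Matrix (Fin 2) (Fin 2) ℤ} (hM : M ∈ sigma0Set N)
    (μ : DInt p) :
    (distρInt p k M μ).1 =
      (weightActD p ℚ_[p] k (norm_entries_of_mem_sigma0Set hpN hM).1 (norm_entries_of_mem_sigma0Set hpN hM).2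
        ((M 0 1 : ℤ) : ℤ_[p]) ((M 1 1 : ℤ) : ℤ_[p]) (DInt.toDist μ)).1 := by
  rw [distρInt_val, distρ_eq k (norm_entries_of_mem_sigma0Set hpN hM)]

end DInt

/-! ### Invariant submodules: `K_n` and `F^N` -/

section Invariant

variable (p) in
/-- The congruence submodule `K_n ⊆ 𝔻⁰` as a submodule of `𝔻⁰`. [folklore] -/
def congrSubInt (n : ℕ) : Submodule ℤ_[p] (DInt p) :=
  ((ProfiniteTower.padicInt p).congrSub p n).comap ((ProfiniteTower.padicInt p).distributionsInt p).subtype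

/-- Membership in `congrSubInt`. [folklore] -/
theorem mem_congrSubInt_iff {n : ℕ} {μ : DInt p} : μ ∈ congrSubInt p n ↔ μ.1 ∈ (ProfiniteTower.padicInt p).congrSub p n :=
  Iff.rfl

variable (p) in
/-- Greenberg's `F^N 𝔻⁰_k` as a submodule of `𝔻⁰`. [folklore] -/
def filGInt (k N : ℕ) : Submodule ℤ_[p] (DInt p) :=
  (filG p k N).comap ((ProfiniteTower.padicInt p).distributionsInt p).subtype

/-- Membership in `filGInt`. [folklore] -/
theorem mem_filGInt_iff {k N : ℕ} {μ : DInt p} : μ ∈ filGInt p k N ↔ μ.1 ∈ filG p k N := Iff.rfl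

/-- **`K_n` is invariant under `𝔻⁰_k`'s action of `Σ₀(N)`.** [cite: GreenbergStevens1993, §1] -/
theorem isInvariant_congrSubInt (k N : ℕ) (hpN : p ∣ N) (n : ℕ) : (distCoeffInt p k N hpN).IsInvariant (congrSubInt p n) := by
  intro M hM μ hμ
  rw [Submodule.mem_comap, mem_congrSubInt_iff, distCoeffInt_ρ, distρInt_val_eq_weightActD k hpN hM]
  exact weightActD_mem_congrSub k _ _ _ _ n (DInt.toDist μ) hμ

/-- **`F^N 𝔻⁰_k` is invariant under the action of `Σ₀(N)`.** [cite: Greenberg2007Lifting, Lemma 2] -/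
theorem isInvariant_filGInt (k N : ℕ) (hpN : p ∣ N) (Nf : ℕ) : (distCoeffInt p k N hpN).IsInvariant (filGInt p k Nf) := by
  intro M hM μ hμ
  rw [Submodule.mem_comap, mem_filGInt_iff, distCoeffInt_ρ, distρInt_val_eq_weightActD k hpN hM]
  exact weightActD_mem_filG k Nf _ _ _ _ (DInt.toDist μ) hμ

/-- The congruence submodules decrease. [folklore] -/
theorem congrSubInt_antitone {n n' : ℕ} (h : n ≤ n') : congrSubInt p n' ≤ congrSubInt p n := by
  intro μ hμ
  rw [mem_congrSubInt_iff] at hμ ⊢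
  refine ⟨hμ.1, fun a => ?_⟩
  have hp1 : (1 : ℝ) ≤ p := by exact_mod_cast (Fact.out : p.Prime).one_lt.le
  exact ((ProfiniteTower.padicInt p).norm_le_of_mem_congrSub hμ h a).trans (zpow_le_zpow_right₀ hp1 (by omega))

end Invariant

/-! ### Finiteness of `𝔻⁰/K_n` -/

section Finite

/-- **`𝔻⁰/K_n` is finite**: the reduction `μ ↦ (μ_n(a) mod p^n)_a` is injective on the quotient.
[cite: GreenbergStevens1993, §1] -/
instance finite_quot_congrSubInt (n : ℕ) : Finite (DInt p ⧸ congrSubInt p n) := by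
  classical
  let f : DInt p ⧸ congrSubInt p n → ((ProfiniteTower.padicInt p).Cell n → ZMod (p ^ n)) :=
    fun q => (ProfiniteTower.padicInt p).reduce n q.out
  refine Finite.of_injective f fun q q' h => ?_
  have hsub : (ProfiniteTower.padicInt p).reduce n (q.out - q'.out) = 0 := by rw [map_sub, sub_eq_zero]; exact h
  have hmem : q.out - q'.out ∈ congrSubInt p n :=
    ((ProfiniteTower.padicInt p).mem_congrSub_iff_reduce_eq_zero n _).mpr hsub
  rw [← Submodule.Quotient.mk_out q, ← Submodule.Quotient.mk_out q']
  exact (Submodule.Quotient.eq _).mpr hmem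

end Finite

/-! ### The finite approximation systems `𝔻⁰/K_n`, their `U_p` and ordinary projector -/

section Approx

variable (p) in
/-- **The finite coefficient system `𝔻⁰_k/K_n` on `Σ₀(N)`.** [cite: GreenbergStevens1993, §1] -/
def approxCoeff (k N : ℕ) (hpN : p ∣ N) (n : ℕ) : CoeffActionOn (sigma0Set N) ℤ_[p] (DInt p ⧸ congrSubInt p n) :=
  (distCoeffInt p k N hpN).quotient (sigma0Set_mulClosed N) (isInvariant_congrSubInt k N hpN n)

/-- The projection `𝔻⁰ → 𝔻⁰/K_n` as a morphism of coefficient systems. [folklore] -/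
def approxHom (k N : ℕ) (hpN : p ∣ N) (n : ℕ) : CoeffActionOn.Hom (distCoeffInt p k N hpN) (approxCoeff p k N hpN n) :=
  (distCoeffInt p k N hpN).mkQHom (sigma0Set_mulClosed N) (isInvariant_congrSubInt k N hpN n)

/-- Elements of `Γ₀(N)` (as elements of `SL₂(ℤ)`) lie in `Σ₀(N)` — the `hΓ` of `hecke_mem_Symb`. [folklore] -/
theorem gamma0_mem_sigma0Set (N : ℕ) : ∀ γ : Gamma0 N, gmat γ ∈ sigma0Set N := fun γ => coe_mem_sigma0Set γ

variable [NeZero p]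

/-- **`U_p` on `Symb_{Γ₀(N)}(𝔻⁰_k/K_n)`.** [cite: GreenbergStevens1993, §1] -/
def heckeApprox (k N : ℕ) (hpN : p ∣ N) (n : ℕ) :
    Module.End ℤ_[p] ((approxCoeff p k N hpN n).Symb (Gamma0 N)) :=
  (approxCoeff p k N hpN n).heckeSymb N p Fact.out (gamma0_mem_sigma0Set N) (fun i => heckeRep_mem_sigma0Set Fact.out i)

/-- **`U_p` on `Symb_{Γ₀(N)}(𝔻⁰_k)`.** [cite: GreenbergStevens1993, §1] -/
def heckeInt (k N : ℕ) (hpN : p ∣ N) : Module.End ℤ_[p] ((distCoeffInt p k N hpN).Symb (Gamma0 N)) :=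
  (distCoeffInt p k N hpN).heckeSymb N p Fact.out (gamma0_mem_sigma0Set N) (fun i => heckeRep_mem_sigma0Set Fact.out i)

/-- The map on symbols `Symb(𝔻⁰) → Symb(𝔻⁰/K_n)`. [folklore] -/
def symbApprox (k N : ℕ) (hpN : p ∣ N) (n : ℕ) :
    (distCoeffInt p k N hpN).Symb (Gamma0 N) →ₗ[ℤ_[p]] (approxCoeff p k N hpN n).Symb (Gamma0 N) :=
  CoeffActionOn.mapSymb _ _ (approxHom k N hpN n) (fun γ hγ => coe_mem_sigma0Set' γ hγ)

/-- **`Symb(𝔻⁰) → Symb(𝔻⁰/K_n)` commutes with `U_p`.** [folklore] -/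
theorem symbApprox_hecke (k N : ℕ) (hpN : p ∣ N) (n : ℕ) :
    (symbApprox k N hpN n).comp (heckeInt k N hpN) = (heckeApprox k N hpN n).comp (symbApprox k N hpN n) := by
  refine LinearMap.ext fun φ => Subtype.ext ?_
  change (approxHom k N hpN n).mapFun ((distCoeffInt p k N hpN).hecke N p φ) =
    (approxCoeff p k N hpN n).hecke N p ((approxHom k N hpN n).mapFun φ)
  exact (approxHom k N hpN n).mapFun_hecke (fun i => heckeRep_mem_sigma0Set Fact.out i) φ

/-- **Hida's ordinary projector on `Symb_{Γ₀(N)}(𝔻⁰_k/K_n)`** (finite module: `finite_Symb` +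
`finite_quot_congrSubInt`). [cite: GreenbergStevens1993, §1] -/
def ordApprox (k N : ℕ) [NeZero N] (hpN : p ∣ N) (n : ℕ) : Module.End ℤ_[p] ((approxCoeff p k N hpN n).Symb (Gamma0 N)) :=
  (approxCoeff p k N hpN n).ordProjSymb (Gamma0 N) (heckeApprox k N hpN n)

/-- `e` is idempotent and commutes with `U_p` on each finite level. [folklore] -/
theorem ordApprox_idem_comm (k N : ℕ) [NeZero N] (hpN : p ∣ N) (n : ℕ) :
    (ordApprox k N hpN n).comp (ordApprox k N hpN n) = ordApprox k N hpN n ∧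
      (ordApprox k N hpN n).comp (heckeApprox k N hpN n) = (heckeApprox k N hpN n).comp (ordApprox k N hpN n) :=
  ⟨(approxCoeff p k N hpN n).ordProjSymb_idem _ _, (approxCoeff p k N hpN n).ordProjSymb_comm _ _⟩

/-! ### Transition maps `𝔻⁰/K_{n'} → 𝔻⁰/K_n` and compatibility of the projectors -/

/-- The transition morphism `𝔻⁰/K_{n'} → 𝔻⁰/K_n` for `n ≤ n'`. [folklore] -/
def transHom (k N : ℕ) (hpN : p ∣ N) {n n' : ℕ} (h : n ≤ n') :
    CoeffActionOn.Hom (approxCoeff p k N hpN n') (approxCoeff p k N hpN n) where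
  toLinearMap := Submodule.mapQ (congrSubInt p n') (congrSubInt p n) LinearMap.id
    (fun μ hμ => by rw [Submodule.mem_comap, LinearMap.id_apply]; exact congrSubInt_antitone h hμ)
  comm M hM x := by
    induction x using Submodule.Quotient.induction_on with
    | H μ =>
      change Submodule.mapQ _ _ LinearMap.id _ ((distCoeffInt p k N hpN).quotientρ _ M (Submodule.Quotient.mk μ)) =
        (distCoeffInt p k N hpN).quotientρ _ M (Submodule.mapQ _ _ LinearMap.id _ (Submodule.Quotient.mk μ))
      rw [(distCoeffInt p k N hpN).quotientρ_mk _ hM, Submodule.mapQ_apply, Submodule.mapQ_apply,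
        (distCoeffInt p k N hpN).quotientρ_mk _ hM]
      rfl

/-- The transition map on symbols. [folklore] -/
def symbTrans (k N : ℕ) (hpN : p ∣ N) {n n' : ℕ} (h : n ≤ n') :
    (approxCoeff p k N hpN n').Symb (Gamma0 N) →ₗ[ℤ_[p]] (approxCoeff p k N hpN n).Symb (Gamma0 N) :=
  CoeffActionOn.mapSymb _ _ (transHom k N hpN h) (fun γ hγ => coe_mem_sigma0Set' γ hγ)

/-- The transition map on symbols commutes with `U_p`. [folklore] -/
theorem symbTrans_hecke (k N : ℕ) (hpN : p ∣ N) {n n' : ℕ} (h : n ≤ n') :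
    (symbTrans k N hpN h).comp (heckeApprox k N hpN n') = (heckeApprox k N hpN n).comp (symbTrans k N hpN h) := by
  refine LinearMap.ext fun φ => Subtype.ext ?_
  change (transHom k N hpN h).mapFun ((approxCoeff p k N hpN n').hecke N p φ) =
    (approxCoeff p k N hpN n).hecke N p ((transHom k N hpN h).mapFun φ)
  exact (transHom k N hpN h).mapFun_hecke (fun i => heckeRep_mem_sigma0Set Fact.out i) φ

/-- **The ordinary projectors are compatible along the tower `𝔻⁰/K_{n'} → 𝔻⁰/K_n`.**
[cite: GreenbergStevens1993, §1] -/
theorem symbTrans_ordApprox (k N : ℕ) [NeZero N] (hpN : p ∣ N) {n n' : ℕ} (h : n ≤ n') :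
    (symbTrans k N hpN h).comp (ordApprox k N hpN n') = (ordApprox k N hpN n).comp (symbTrans k N hpN h) :=
  CoeffActionOn.mapSymb_ordProjSymb _ _ (transHom k N hpN h) _ (symbTrans_hecke k N hpN h)

end Approx

end Literature.NumberTheory.EllipticCurves

end
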